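/-
Copyright: the b2b-balaban T⁴-continuum CRUX team, row NE7b leaf lineage `t4-ne7b-formalise-leaf-06` (gen 150). Project licence.
-/
import Summits.QuantumFields.BalabanUV.T4Continuum.Spine.NE7b.AnalyticHessianLetter

/-!
# THE OPERATOR-NORM LETTERS FROM ANALYTICITY: `‖D(Re E)(p)‖ ≤ M∕δ` and `‖D²(Re E)(p)‖ ≤ 4M∕δ²` for a functional holomorphic and
# bounded by `M` on a complex `δ`-neighbourhood — the first-order companion of `…AnalyticHessianLetter` (Cauchy, `n = 1`) and its
# mixed letter read as an operator norm (row NE7b, node U5c; supplier of the road's displayed `g`, `L` letters, kernel lemmas)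

Cell `pub-balaban`, sub-cell `t4`, spine estimate NE7b (`T4WeightBudget.RelWeightBound`; the cell's OWN estimate — NOT PRINTED in
[Bałaban 1983–89], NOT PROVED).  Crux-route work under `Spine/NE7b/` by a row leaf on the convexity road; NOTHING of Bałaban's is
named, valued or asserted; no `T4Continuum/Support` leaf typed; no `def`; zero `sorry`.  Imports: the sibling `…AnalyticHessianLetter`
only (its §1 real traces, §2 slices, §3 chart plumbing BY NAME).

WHY.  Besides Hessian-smallness letters the road displays GRADIENT letters at single points and Hessian OPERATOR norms: leaf-01's
`…HessianChartTransport` (`hg : ‖DV(φ x)‖ ≤ g`, `hL : ‖D²V(y)‖ ≤ L` on the window, `‖DV(y₀)‖` at the chart's centre), the OWNER's `…ConvexWindowTiltRecentred` ∕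
`…ConvexWindowExponentShift` (`‖∇V x₀‖` ∕ `‖∇W x₀‖` at the expansion point), `…ConvexWindowTaylorGrowth` (`‖w‖ = ‖∇W x₀‖`).  In print's
currency — analyticity with a sup bound `M` on a complex `δ`-neighbourhood ([B12] CMP 109 §1; Dimock I §4, BY SHAPE only) — the same
Cauchy mechanism that gives the sibling's `2M∕δ²` gives `M∕δ` for the gradient; this file types it (it was cut from the sibling for the
400-line bound) and states it in OPERATOR-NORM currency, the shape those sockets display.

WHAT IS PROVED ([folklore]: Cauchy's inequality for `n = 1`, Mathlib's `Complex.norm_iteratedDeriv_le_of_forall_mem_sphere_norm_le` BY NAME):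
* §1 `norm_deriv_le` (`‖g′(c)‖ ≤ M∕r` for `g` holomorphic on an open `S ⊇ closedBall c r`, `‖g‖ ≤ M` on the circle), `abs_deriv_re_le`
  (`|(Re g)′(s₀)| ≤ M∕r`), `deriv_lineSlice` (`(s ↦ P(x + s v))′(0) = DP(x)[v]` for `P ∈ Cⁿ`, `n ≠ 0`, on an open `O ∋ x`), THE MECHANISM
  `abs_fderiv_le_of_holomorphicSlice` (`|DP(x)[v]| ≤ M∕r` when the slice is the real trace of such a `g`).
* §2 through a real-linear chart `J : V →L[ℝ] W`, `P y = Re E(J y)`, `E ∈ Cⁿ(U)` over `ℂ` (`n ≠ 0`), `‖E‖ ≤ M` on `U`: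
  `abs_fderiv_chart_le_of_disc` (any `J`, disc form), and for a CONTRACTIVE chart (`‖J v‖ ≤ ‖v‖`) with `closedBall (J x) δ ⊆ U`:
  `abs_fderiv_chart_le` (`|DP(x)[v]| ≤ (M∕δ)‖v‖`), **`norm_fderiv_chart_le`** (`‖DP(x)‖ ≤ M∕δ`, operator norm),
  **`norm_iteratedFDeriv_two_chart_le`** (`‖D²P(x)‖ ≤ 4M∕δ²`, the parent's mixed letter by `opNorm_le_bound` — the `hL` letter of
  `…HessianChartTransport`), and the window letters **`fderivOn_chart_norm_le`** ∕ `iteratedFDerivOn_two_chart_norm_le`.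
* §3 `J = id`: `abs_fderiv_re_le`, **`norm_fderiv_re_le`** (`‖D(Re E)(p)‖ ≤ M∕δ`), `norm_iteratedFDeriv_two_re_le` (`‖D²(Re E)(p)‖ ≤ 4M∕δ²`);
  §4 lattice fields (`ι → ℝ ↪ ι → ℂ`, sup norms):
  **`norm_fderiv_lattice_le`**; §5 a toy (`E z = z²` on `ball 0 2 ⊆ ℂ`, `M = 4`, `δ = 1`: `‖D(Re z²)(0)‖ ≤ 4`).

NOT HERE (honest): the `ℓ²` (`EuclideanSpace`) and `gradient`-valued spellings (one `simp [EuclideanSpace …]` ∕ `norm_gradient` step for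
the consumer; the contractive-chart theorem already covers `ℓ² → ℓ^∞`); higher derivatives `k!·M∕δᵏ` (the sibling has `k = 2`); WHICH
functional with WHICH `(M, δ)` — (A3) ∕ (A1c), NC-NE7b-α UNRULED; anything of Bałaban's.  BY-NAME EFFECT ON THE WALL: NONE.  NE7b NOT
PRINTED ∕ NOT PROVED; spine PROVED 0∕9; rung (B)+1 on a FINITE torus — NOT infinite volume, NOT the mass gap, NOT Clay.
HONEST DEPENDENCY: continuum YM on T⁴ ⇐ BetaPertH ∧ nine spine estimates (0/9 proved); BetaPertH ⇐ (D1) ∧ (D4) ∧ CAP+tail.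
-/

set_option autoImplicit false

open Set Filter Metric Topology
open Summit.QuantumFields.BalabanUV.T4Continuum.NE7b.AnalyticHessianLetter

namespace Summit.QuantumFields.BalabanUV.T4Continuum.NE7b.AnalyticGradientLetter

/-! ## §1 One complex variable (`n = 1`), slices, and the mechanism -/

section OneVariable

variable {g : ℂ → ℂ} {S : Set ℂ}

/-- **CAUCHY'S INEQUALITY, FIRST DERIVATIVE**: `g` holomorphic on an open `S ⊇ closedBall c r`, `‖g‖ ≤ M` on the circle ⟹
`‖g′(c)‖ ≤ M∕r`. [folklore] -/
theorem norm_deriv_le (hg : DifferentiableOn ℂ g S) {c : ℂ} {r M : ℝ} (hr : 0 < r) (hsub : closedBall c r ⊆ S)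
    (hM : ∀ t ∈ sphere c r, ‖g t‖ ≤ M) : ‖deriv g c‖ ≤ M / r := by
  simpa using Complex.norm_iteratedDeriv_le_of_forall_mem_sphere_norm_le 1 hr (hg.diffContOnCl_ball hsub) hM

/-- `|(Re g)′(s₀)| ≤ M∕r` at a real point `s₀` with `closedBall s₀ r ⊆ S`. [folklore] -/
theorem abs_deriv_re_le (hS : IsOpen S) (hg : DifferentiableOn ℂ g S) {s₀ : ℝ} {r M : ℝ} (hr : 0 < r)
    (hsub : closedBall (s₀ : ℂ) r ⊆ S) (hM : ∀ t ∈ sphere (s₀ : ℂ) r, ‖g t‖ ≤ M) :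
    |deriv (fun s : ℝ => (g s).re) s₀| ≤ M / r := by
  rw [deriv_re_ofReal hS hg (hsub (mem_closedBall_self hr.le))]
  exact (Complex.abs_re_le_norm _).trans (norm_deriv_le hg hr hsub hM)

end OneVariable

section LineSlice

variable {V : Type*} [NormedAddCommGroup V] [NormedSpace ℝ V] {F : Type*} [NormedAddCommGroup F] [NormedSpace ℝ F]

/-- `(s ↦ P(x + s v))′(0) = DP(x)[v]` for `P` of class `Cⁿ`, `n ≠ 0`, on an open `O ∋ x`. [folklore] -/
theorem deriv_lineSlice {P : V → F} {O : Set V} (hO : IsOpen O) {n : WithTop ℕ∞} (hP : ContDiffOn ℝ n P O) (hn : n ≠ 0)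
    {x : V} (hx : x ∈ O) (v : V) : deriv (fun s : ℝ => P (x + s • v)) 0 = fderiv ℝ P x v := by
  have h : HasFDerivAt P (fderiv ℝ P x) (x + (0 : ℝ) • v) := by
    simpa using ((hP.differentiableOn hn).differentiableAt (hO.mem_nhds hx)).hasFDerivAt
  exact (hasDerivAt_lineSlice h).deriv

/-- **THE CAUCHY MECHANISM, GRADIENT**: `P ∈ Cⁿ(O)` (`n ≠ 0`, `O` open ∋ `x`) whose slice along `v` is the real trace of a `g`
holomorphic on an open `S ⊇ closedBall 0 r` with `‖g‖ ≤ M` on `|t| = r` ⟹ `|DP(x)[v]| ≤ M∕r`. [folklore] -/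
theorem abs_fderiv_le_of_holomorphicSlice {P : V → ℝ} {O : Set V} (hO : IsOpen O) {n : WithTop ℕ∞} (hP : ContDiffOn ℝ n P O)
    (hn : n ≠ 0) {x : V} (hx : x ∈ O) {v : V} {g : ℂ → ℂ} {S : Set ℂ} (hS : IsOpen S) (hg : DifferentiableOn ℂ g S) {r M : ℝ}
    (hr : 0 < r) (hsub : closedBall (0 : ℂ) r ⊆ S) (hM : ∀ t ∈ sphere (0 : ℂ) r, ‖g t‖ ≤ M)
    (hslice : ∀ s : ℝ, (s : ℂ) ∈ S → P (x + s • v) = (g s).re) :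
    |fderiv ℝ P x v| ≤ M / r := by
  rw [← deriv_lineSlice hO hP hn hx v]
  have h0 : ((0 : ℝ) : ℂ) ∈ S := by simpa using hsub (mem_closedBall_self hr.le)
  have heq : (fun s : ℝ => P (x + s • v)) =ᶠ[𝓝 0] fun s => (g s).re :=
    (eventually_ofReal_mem hS h0).mono fun s hs => hslice s hs
  rw [heq.deriv_eq]
  exact abs_deriv_re_le hS hg hr (by simpa using hsub) (by simpa using hM)

end LineSlice

/-! ## §2 Through a real-linear chart `J : V →L[ℝ] W`: `P y = Re E(J y)` -/

section Chart

variable {V : Type*} [NormedAddCommGroup V] [NormedSpace ℝ V] {W : Type*} [NormedAddCommGroup W] [NormedSpace ℂ W]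
  {E : W → ℂ} {U : Set W} {M : ℝ}

/-- **GRADIENT LETTER ALONG ONE DIRECTION, ANY CHART**: `E ∈ Cⁿ(U)` over `ℂ` (`n ≠ 0`), `‖E‖ ≤ M` on `U`, the closed complex disc
`{J x + t·J v : |t| ≤ r}` inside `U` ⟹ `|DP(x)[v]| ≤ M∕r`. [folklore] -/
theorem abs_fderiv_chart_le_of_disc (J : V →L[ℝ] W) (hU : IsOpen U) {n : WithTop ℕ∞} (hE : ContDiffOn ℂ n E U) (hn : n ≠ 0)
    (hM : ∀ q ∈ U, ‖E q‖ ≤ M) {x v : V} {r : ℝ} (hr : 0 < r) (hsub : ∀ t : ℂ, ‖t‖ ≤ r → J x + t • J v ∈ U) :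
    |fderiv ℝ (fun y => (E (J y)).re) x v| ≤ M / r := by
  have hx : x ∈ J ⁻¹' U := by simpa using hsub 0 (by simpa using hr.le)
  refine abs_fderiv_le_of_holomorphicSlice (hU.preimage J.continuous) (contDiffOn_re_comp J hE) hn hx
    (isOpen_slice hU (J x) (J v)) (differentiableOn_slice (hE.differentiableOn hn) (J x) (J v)) hr ?_ ?_ ?_
  · intro t ht
    exact hsub t (by simpa using ht)
  · intro t ht
    exact hM _ (hsub t (le_of_eq (by simpa using ht)))
  · intro s _
    simp [map_add, map_smul]

/-- **GRADIENT LETTER** (contractive chart `‖J v‖ ≤ ‖v‖`, `closedBall (J x) δ ⊆ U`): `|DP(x)[v]| ≤ (M∕δ)‖v‖`. [folklore] -/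
theorem abs_fderiv_chart_le (J : V →L[ℝ] W) (hJ : ∀ v, ‖J v‖ ≤ ‖v‖) (hU : IsOpen U) {n : WithTop ℕ∞} (hE : ContDiffOn ℂ n E U)
    (hn : n ≠ 0) (hM : ∀ q ∈ U, ‖E q‖ ≤ M) {x : V} {δ : ℝ} (hδ : 0 < δ) (hsub : closedBall (J x) δ ⊆ U) (v : V) :
    |fderiv ℝ (fun y => (E (J y)).re) x v| ≤ M / δ * ‖v‖ := by
  by_cases hv : v = 0
  · subst hv
    simp
  have hvn : 0 < ‖v‖ := norm_pos_iff.mpr hv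
  have h := abs_fderiv_chart_le_of_disc J hU hE hn hM (div_pos hδ hvn) (chart_disc_subset J hJ hvn hsub)
  calc |fderiv ℝ (fun y => (E (J y)).re) x v| ≤ M / (δ / ‖v‖) := h
    _ = M / δ * ‖v‖ := by field_simp

/-- **GRADIENT LETTER, OPERATOR NORM** (contractive chart, `closedBall (J x) δ ⊆ U`): `‖DP(x)‖ ≤ M∕δ`. [folklore] -/
theorem norm_fderiv_chart_le (J : V →L[ℝ] W) (hJ : ∀ v, ‖J v‖ ≤ ‖v‖) (hU : IsOpen U) {n : WithTop ℕ∞} (hE : ContDiffOn ℂ n E U)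
    (hn : n ≠ 0) (hM : ∀ q ∈ U, ‖E q‖ ≤ M) {x : V} {δ : ℝ} (hδ : 0 < δ) (hsub : closedBall (J x) δ ⊆ U) :
    ‖fderiv ℝ (fun y => (E (J y)).re) x‖ ≤ M / δ := by
  have hM0 : 0 ≤ M := (norm_nonneg _).trans (hM _ (hsub (mem_closedBall_self hδ.le)))
  refine ContinuousLinearMap.opNorm_le_bound _ (div_nonneg hM0 hδ.le) fun v => ?_
  rw [Real.norm_eq_abs]
  exact abs_fderiv_chart_le J hJ hU hE hn hM hδ hsub v

/-- **HESSIAN LETTER, OPERATOR NORM** (contractive chart, `closedBall (J x) δ ⊆ U`, `E ∈ C²(U)`): `‖D²P(x)‖ ≤ 4M∕δ²` — the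
parent's mixed letter `|D²P(x)[v,w]| ≤ (4M∕δ²)‖v‖‖w‖` read as an operator-norm bound (the `hL` letter of `…HessianChartTransport`). [folklore] -/
theorem norm_iteratedFDeriv_two_chart_le (J : V →L[ℝ] W) (hJ : ∀ v, ‖J v‖ ≤ ‖v‖) (hU : IsOpen U) (hE : ContDiffOn ℂ 2 E U)
    (hM : ∀ q ∈ U, ‖E q‖ ≤ M) {x : V} {δ : ℝ} (hδ : 0 < δ) (hsub : closedBall (J x) δ ⊆ U) :
    ‖iteratedFDeriv ℝ 2 (fun y => (E (J y)).re) x‖ ≤ 4 * M / δ ^ 2 := by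
  have hM0 : 0 ≤ M := (norm_nonneg _).trans (hM _ (hsub (mem_closedBall_self hδ.le)))
  refine ContinuousMultilinearMap.opNorm_le_bound (by positivity) fun m => ?_
  rw [iteratedFDeriv_two_apply, Fin.prod_univ_two, Real.norm_eq_abs]
  calc |fderiv ℝ (fderiv ℝ (fun y => (E (J y)).re)) x (m 0) (m 1)| ≤ 4 * M / δ ^ 2 * ‖m 0‖ * ‖m 1‖ :=
        abs_hessian_chart_mixed_le J hJ hU hE hM hδ hsub (m 0) (m 1)
    _ = 4 * M / δ ^ 2 * (‖m 0‖ * ‖m 1‖) := by ring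

/-- **THE WINDOW HESSIAN LETTER, OPERATOR NORM**: `∀ x ∈ K, ‖D²P(x)‖ ≤ 4M∕δ²` once `closedBall (J x) δ ⊆ U` for `x ∈ K`. [folklore] -/
theorem iteratedFDerivOn_two_chart_norm_le (J : V →L[ℝ] W) (hJ : ∀ v, ‖J v‖ ≤ ‖v‖) (hU : IsOpen U) (hE : ContDiffOn ℂ 2 E U)
    (hM : ∀ q ∈ U, ‖E q‖ ≤ M) {K : Set V} {δ : ℝ} (hδ : 0 < δ) (hK : ∀ x ∈ K, closedBall (J x) δ ⊆ U) :
    ∀ x ∈ K, ‖iteratedFDeriv ℝ 2 (fun y => (E (J y)).re) x‖ ≤ 4 * M / δ ^ 2 :=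
  fun x hx => norm_iteratedFDeriv_two_chart_le J hJ hU hE hM hδ (hK x hx)

/-- **THE WINDOW GRADIENT LETTER**: `closedBall (J x) δ ⊆ U` for every `x ∈ K` ⟹ `∀ x ∈ K, ‖DP(x)‖ ≤ M∕δ`. [folklore] -/
theorem fderivOn_chart_norm_le (J : V →L[ℝ] W) (hJ : ∀ v, ‖J v‖ ≤ ‖v‖) (hU : IsOpen U) {n : WithTop ℕ∞} (hE : ContDiffOn ℂ n E U)
    (hn : n ≠ 0) (hM : ∀ q ∈ U, ‖E q‖ ≤ M) {K : Set V} {δ : ℝ} (hδ : 0 < δ) (hK : ∀ x ∈ K, closedBall (J x) δ ⊆ U) :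
    ∀ x ∈ K, ‖fderiv ℝ (fun y => (E (J y)).re) x‖ ≤ M / δ :=
  fun x hx => norm_fderiv_chart_le J hJ hU hE hn hM hδ (hK x hx)

end Chart

/-! ## §3 On the complex space itself (`J = id`) -/

section Self

variable {W : Type*} [NormedAddCommGroup W] [NormedSpace ℂ W] {E : W → ℂ} {U : Set W} {M : ℝ}

/-- **GRADIENT LETTER ON `W`**: `E ∈ Cⁿ(U)` over `ℂ`, `n ≠ 0`, `‖E‖ ≤ M` on `U`, `closedBall p δ ⊆ U` ⟹ `|D(Re E)(p)[z]| ≤ (M∕δ)‖z‖`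
(derivative over `ℝ`). [folklore] -/
theorem abs_fderiv_re_le (hU : IsOpen U) {n : WithTop ℕ∞} (hE : ContDiffOn ℂ n E U) (hn : n ≠ 0) (hM : ∀ q ∈ U, ‖E q‖ ≤ M)
    {p : W} {δ : ℝ} (hδ : 0 < δ) (hsub : closedBall p δ ⊆ U) (z : W) :
    |fderiv ℝ (fun q => (E q).re) p z| ≤ M / δ * ‖z‖ :=
  abs_fderiv_chart_le (ContinuousLinearMap.id ℝ W) (fun _ => le_rfl) hU hE hn hM hδ (by simpa using hsub) z

/-- **HESSIAN LETTER ON `W`, OPERATOR NORM**: `‖D²(Re E)(p)‖ ≤ 4M∕δ²` (over `ℝ`). [folklore] -/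
theorem norm_iteratedFDeriv_two_re_le (hU : IsOpen U) (hE : ContDiffOn ℂ 2 E U) (hM : ∀ q ∈ U, ‖E q‖ ≤ M) {p : W} {δ : ℝ}
    (hδ : 0 < δ) (hsub : closedBall p δ ⊆ U) : ‖iteratedFDeriv ℝ 2 (fun q => (E q).re) p‖ ≤ 4 * M / δ ^ 2 :=
  norm_iteratedFDeriv_two_chart_le (ContinuousLinearMap.id ℝ W) (fun _ => le_rfl) hU hE hM hδ (by simpa using hsub)

/-- **GRADIENT LETTER ON `W`, OPERATOR NORM**: `‖D(Re E)(p)‖ ≤ M∕δ`. [folklore] -/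
theorem norm_fderiv_re_le (hU : IsOpen U) {n : WithTop ℕ∞} (hE : ContDiffOn ℂ n E U) (hn : n ≠ 0) (hM : ∀ q ∈ U, ‖E q‖ ≤ M)
    {p : W} {δ : ℝ} (hδ : 0 < δ) (hsub : closedBall p δ ⊆ U) : ‖fderiv ℝ (fun q => (E q).re) p‖ ≤ M / δ :=
  norm_fderiv_chart_le (ContinuousLinearMap.id ℝ W) (fun _ => le_rfl) hU hE hn hM hδ (by simpa using hsub)

end Self

/-! ## §4 Lattice fields: `ι → ℝ ↪ ι → ℂ` componentwise, sup norms (closed balls are polydiscs) -/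

section Lattice

variable {ι : Type*} [Fintype ι] {E : (ι → ℂ) → ℂ} {U : Set (ι → ℂ)} {M : ℝ}

/-- **GRADIENT LETTER FOR LATTICE FIELDS, OPERATOR NORM**: `E ∈ Cⁿ(U)` over `ℂ` (`n ≠ 0`) with `‖E‖ ≤ M` on an open `U ⊆ ι → ℂ`
and the closed `δ`-polydisc about the real field `x` inside `U` ⟹ `‖D(y ↦ Re E(↑y))(x)‖ ≤ M∕δ` (sup norms). [folklore] -/
theorem norm_fderiv_lattice_le (hU : IsOpen U) {n : WithTop ℕ∞} (hE : ContDiffOn ℂ n E U) (hn : n ≠ 0) (hM : ∀ q ∈ U, ‖E q‖ ≤ M)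
    {x : ι → ℝ} {δ : ℝ} (hδ : 0 < δ) (hsub : closedBall (fun i => (x i : ℂ)) δ ⊆ U) :
    ‖fderiv ℝ (fun y : ι → ℝ => (E (fun i => (y i : ℂ))).re) x‖ ≤ M / δ := by
  set J : (ι → ℝ) →L[ℝ] (ι → ℂ) := ContinuousLinearMap.pi fun i => Complex.ofRealCLM.comp (ContinuousLinearMap.proj i)
    with hJ
  have hJa : ∀ y : ι → ℝ, J y = fun i => (y i : ℂ) := fun y => by ext i; simp [hJ]
  have hJn : ∀ y : ι → ℝ, ‖J y‖ ≤ ‖y‖ := fun y => by rw [hJa, norm_ofReal_pi]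
  have hP : (fun y : ι → ℝ => (E (fun i => (y i : ℂ))).re) = fun y => (E (J y)).re := by funext y; rw [hJa]
  rw [hP]
  exact norm_fderiv_chart_le J hJn hU hE hn hM hδ (by rwa [hJa])

/-- **THE WINDOW GRADIENT LETTER FOR LATTICE FIELDS**: `∀ x ∈ K, ‖D(y ↦ Re E(↑y))(x)‖ ≤ M∕δ` once the closed `δ`-polydisc about
every `↑x`, `x ∈ K`, lies in `U`. [folklore] -/
theorem fderivOn_lattice_norm_le (hU : IsOpen U) {n : WithTop ℕ∞} (hE : ContDiffOn ℂ n E U) (hn : n ≠ 0)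
    (hM : ∀ q ∈ U, ‖E q‖ ≤ M) {K : Set (ι → ℝ)} {δ : ℝ} (hδ : 0 < δ) (hK : ∀ x ∈ K, closedBall (fun i => (x i : ℂ)) δ ⊆ U) :
    ∀ x ∈ K, ‖fderiv ℝ (fun y : ι → ℝ => (E (fun i => (y i : ℂ))).re) x‖ ≤ M / δ :=
  fun x hx => norm_fderiv_lattice_le hU hE hn hM hδ (hK x hx)

end Lattice

/-! ## §5 Toy: the hypotheses are jointly inhabited (`E z = z²` on `ball 0 2 ⊆ ℂ`, `M = 4`, `δ = 1`) -/

/-- Toy instance of `norm_fderiv_re_le`: `‖D(Re z²)(0)‖ ≤ 4∕1` (the true value is `0`). [folklore] -/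
example : ‖fderiv ℝ (fun q : ℂ => (q ^ 2).re) 0‖ ≤ 4 / 1 := by
  refine norm_fderiv_re_le (E := fun q : ℂ => q ^ 2) (U := ball (0 : ℂ) 2) (M := 4) (n := 2) isOpen_ball
    ((contDiff_id.pow 2).contDiffOn) two_ne_zero ?_ one_pos ?_
  · intro q hq
    rw [norm_pow]
    have hq' : ‖q‖ < 2 := by simpa using hq
    nlinarith [norm_nonneg q]
  · simpa using (closedBall_subset_ball (by norm_num : (1 : ℝ) < 2))

end Summit.QuantumFields.BalabanUV.T4Continuum.NE7b.AnalyticGradientLetter
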